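import Summits.KontsevichZagierPeriods.Zeta5Search.Barrier.ConeGammaTranslateLexGerm

/-!
# ζ(5) search — BARRIER: TIES OF ANY MULTIPLICITY — the kink of `σ` and of `P` at a displacement is bounded by the junction counts
# of its tied walls; ties on junction-free walls are invisible (file (5) of «THE LEXICOGRAPHIC GERM»)

HONEST FRAMING (cell `pub-zeta5`): systematic search; no irrationality claim unless kernel-certified. MODEL objects
under Brown–Zudilin's (28)+(30) accounting ([BZ22] = arXiv:2210.03391; (28) observed, not proved); nothing here is a
statement about `ζ(5)`, any `γ` of record, the cone's supremum (C2 OPEN) or the value / sign of `σ`, `P`, a kink or a junction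
count at a named direction (DATA of the cell); NO cancellation is quantified; S-E / (TD_A) stay CONJECTURED; records in print
UNMOVED. Prover P2 g42 (item «THE LEXICOGRAPHIC GERM», file (5); plan INBOX 2026-08-28). Sources: files (1)–(4) of the item, P2
g32/g33 `ConeGammaCuspPeriodCanonical` (THE JUNCTION-COUNT GAUGE `cuspSlope_le_greedy_add_countGauge_canonical` /
`greedy_sub_countGauge_le_cuspSlope_canonical`: `|σ(δ') − G_{δ₀}(δ')| ≤ Σ_{walls inverted between δ₀ and δ'} J_{kl}·|r_k(δ') − r_l(δ')|`,
`J_{kl}` the number of junctions of the period on the wall `{k, l}`).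

SETTING. `a` with all 28 forms positive, `T > 0` a period, `σ = cuspSlope a T`, `P = translateIntegral a T`, `F` the canonical
period pattern function, rates `r_k(θ) = φ_k(θ)/h_k(a)`, `J_{kl} = #{m < #bkpts − 1 : b_m·h_k(a) ∈ ℤ ∧ b_m·h_l(a) ∈ ℤ}`. A
displacement `δ` may have ties of ANY multiplicity (several coincident rates, several tied classes); file (2) treated ONE tie.
* **`cuspSlope_symm_add_smul_abs_le` — THE KINK OF `σ` AT `δ` IS BOUNDED BY THE JUNCTION COUNTS OF ITS TIED WALLS**: for EVERY
  `δ, Δ` there is `t₀ > 0` with **`|σ(δ + t·Δ) + σ(δ − t·Δ) − 2σ(δ)| ≤ t·Σ_{k ≠ l, r_k(δ) = r_l(δ)} J_{kl}·max(r_k(Δ) − r_l(Δ), 0)`**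
  on `[0, t₀]` (each unordered tied pair contributes `J_{kl}·|r_k(Δ) − r_l(Δ)|` once): with the lexicographic reference `δ₀⁻` of
  `(δ, −Δ)`, `σ(δ − t·Δ)` and `σ(δ)` ARE the chamber functional of `δ₀⁻`, and the only walls inverted between `δ₀⁻` and
  `δ + t·Δ` are the tied walls of `δ` split by `Δ`, with splitting `t·|r_k(Δ) − r_l(Δ)|`;
* **`cuspSlope_symm_add_smul_eq_zero_of_no_junction`** — if NO tied wall of `δ` carries a junction of the period (`J_{kl} = 0` for
  every tie `r_k(δ) = r_l(δ)`, `k ≠ l`), then `σ(δ + t·Δ) + σ(δ − t·Δ) − 2σ(δ) = 0` on `[0, t₀]` for EVERY `Δ`: such ties are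
  INVISIBLE; **`cuspSlope_eq_greedy_near_of_no_junction`** — indeed `σ` IS the chamber functional of any generic refinement `δ₀` of
  `δ` on a whole NEIGHBOURHOOD of `δ` (the junction-count gauge vanishes there);
* **`translateIntegral_symm_add_smul_abs_le`**, **`hasFDerivAt_translateIntegral_of_no_junction`** — the same for `P` on the open
  rate ball (file (3): `P = P(0) + σ` there): the kink of `P` at ANY translate of the ball is bounded by the junction counts of its
  tied walls, and **`P` is Fréchet-differentiable at every translate of the ball whose tied walls carry no junction**, with
  derivative the chamber functional of any generic refinement — file (4)'s `hasFDerivAt_translateIntegral_of_rates_lt` is the case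
  of no tie. READING: inside the coherence ball the walls of the translate arrangement that can kink `P` are EXACTLY the rate
  walls `ρ_k = ρ_l` with `J_{kl} ≥ 1` (both forms members of a common junction of the period); the kink across such a wall is an
  integer multiple of its covector, `|m| ≤ J_{kl}` (file (4)), and at a multiple tie the kinks add up wall by wall within the bound.
NOT here (honest): the junction counts, kinks or derivative at a named direction (DATA); the exact kink at a multiple tie as a
signed sum (only the two-sided bound); beyond the ball ((TD_A) CONJECTURED); `Φ`, `γ`, C2, S-E's truth, `ζ(5)`.
-/

noncomputable section

open Set Finset Filter
open scoped Topology

namespace Summit.KontsevichZagierPeriods.Zeta5Search.Barrier.ConeGamma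

/-! ### The junction-count gauge along a segment: only the tied walls split by `Δ` are inverted -/

open scoped Classical in
/-- **Termwise bound of the gauge along a segment.** Let `δ₀` refine the lexicographic order of `(δ, −Δ)` and let `t` lie in the
lexicographic window of `(δ, Δ)` (`0 < t`, the strict rate inequalities of `δ + t·Δ` are the lexicographic ones). Then for all
`k, l`: the gauge term of the wall `{k,l}` at `δ + t·Δ` relative to `δ₀` is at most `t` times the tie term
`[k ≠ l ∧ r_k(δ) = r_l(δ)]·J·max(r_k(Δ) − r_l(Δ), 0)` (`J ≥ 0` any weight). -/
theorem gauge_term_le_tie_term {a : Dir} {δ Δ δ₀ : Fin 8 → ℝ} {t : ℝ} (ht : 0 < t)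
    (hwin : ∀ k l : Fin 28, (phiForm (δ + t • Δ) k / h28 a k < phiForm (δ + t • Δ) l / h28 a l ↔
      (phiForm δ k / h28 a k < phiForm δ l / h28 a l ∨
        (phiForm δ k / h28 a k = phiForm δ l / h28 a l ∧ phiForm Δ k / h28 a k < phiForm Δ l / h28 a l))))
    (hlex' : ∀ k l : Fin 28, (phiForm δ k / h28 a k < phiForm δ l / h28 a l ∨
        (phiForm δ k / h28 a k = phiForm δ l / h28 a l ∧ phiForm Δ l / h28 a l < phiForm Δ k / h28 a k)) →
      phiForm δ₀ k / h28 a k < phiForm δ₀ l / h28 a l)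
    {J : ℝ} (hJ : 0 ≤ J) (k l : Fin 28) :
    (if phiForm δ₀ k / h28 a k < phiForm δ₀ l / h28 a l then
        J * max (phiForm (δ + t • Δ) k / h28 a k - phiForm (δ + t • Δ) l / h28 a l) 0 else 0) ≤
      t * (if k ≠ l ∧ phiForm δ k / h28 a k = phiForm δ l / h28 a l then
        J * max (phiForm Δ k / h28 a k - phiForm Δ l / h28 a l) 0 else 0) := by
  have hR : 0 ≤ t * (if k ≠ l ∧ phiForm δ k / h28 a k = phiForm δ l / h28 a l then
      J * max (phiForm Δ k / h28 a k - phiForm Δ l / h28 a l) 0 else 0) := by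
    refine mul_nonneg ht.le ?_
    split_ifs
    · exact mul_nonneg hJ (le_max_right _ _)
    · exact le_rfl
  by_cases h0 : phiForm δ₀ k / h28 a k < phiForm δ₀ l / h28 a l
  · rw [if_pos h0]
    have hkl : k ≠ l := fun h => by rw [h] at h0; exact lt_irrefl _ h0
    rcases lt_trichotomy (phiForm δ k / h28 a k) (phiForm δ l / h28 a l) with h | h | h
    · -- not a tie: no inversion inside the window
      have h1 : phiForm (δ + t • Δ) k / h28 a k < phiForm (δ + t • Δ) l / h28 a l := (hwin k l).mpr (Or.inl h)
      rw [max_eq_right (by linarith), mul_zero]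
      exact hR
    · -- a tie: the splitting is `t·(r_k(Δ) − r_l(Δ))`
      rw [if_pos ⟨hkl, h⟩]
      have e : phiForm (δ + t • Δ) k / h28 a k - phiForm (δ + t • Δ) l / h28 a l =
          t * (phiForm Δ k / h28 a k - phiForm Δ l / h28 a l) := by
        rw [rate_add_smul, rate_add_smul, h]; ring
      rw [e, ← mul_zero t, ← mul_max_of_nonneg _ _ ht.le]
      exact le_of_eq (by ring)
    · exact absurd ((hlex' l k (Or.inl h)).trans h0) (lt_irrefl _)
  · rw [if_neg h0]
    exact hR

/-! ### The kink of the cusp slope is bounded by the junction counts of the tied walls -/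

open scoped Classical in
/-- **THE KINK OF `σ` AT `δ` ACROSS `Δ` IS BOUNDED BY THE JUNCTION COUNTS OF THE TIED WALLS OF `δ`.** All 28 forms of `a`
positive, `T > 0` a period, `F` the canonical period pattern function. For EVERY `δ, Δ` there is `t₀ > 0` such that for all
`t ∈ [0, t₀]`:
`|σ(δ + t·Δ) + σ(δ − t·Δ) − 2σ(δ)| ≤ t·Σ_k Σ_l [k ≠ l ∧ r_k(δ) = r_l(δ)]·J_{kl}·max(r_k(Δ) − r_l(Δ), 0)`,
`J_{kl} = #{m < #bkpts − 1 : b_m·h_k(a) ∈ ℤ ∧ b_m·h_l(a) ∈ ℤ}` — ties of ANY multiplicity. -/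
theorem cuspSlope_symm_add_smul_abs_le {a : Dir} (hpos : ∀ k, 0 < h28 a k) {T : ℝ} (hT : 0 < T)
    (hper : ∀ k : Fin 28, ∃ z : ℤ, T * h28 a k = z) {F : Finset (Fin 28) → ℝ}
    (hF : ∀ A, F A = ∑ m ∈ Finset.range ((bkpts a T).card - 1), ((patternN a (bkpt a T m) A : ℤ) : ℝ))
    (δ Δ : Fin 8 → ℝ) :
    ∃ t₀ : ℝ, 0 < t₀ ∧ ∀ t ∈ Icc (0 : ℝ) t₀,
      |cuspSlope a T (δ + t • Δ) + cuspSlope a T (δ - t • Δ) - 2 * cuspSlope a T δ| ≤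
        t * ∑ k, ∑ l, if k ≠ l ∧ phiForm δ k / h28 a k = phiForm δ l / h28 a l then
          ((((Finset.range ((bkpts a T).card - 1)).filter fun m =>
              (∃ z : ℤ, bkpt a T m * h28 a k = z) ∧ ∃ z : ℤ, bkpt a T m * h28 a l = z).card : ℕ) : ℝ) *
            max (phiForm Δ k / h28 a k - phiForm Δ l / h28 a l) 0 else 0 := by
  -- the lexicographic reference of `(δ, −Δ)` and the two windows
  obtain ⟨δ₀, hgen, hlex₀⟩ := exists_generic_refines_lex hpos δ (-Δ)
  have hneg : ∀ k, phiForm (-Δ) k / h28 a k = -(phiForm Δ k / h28 a k) := fun k => by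
    rw [phiForm_neg, neg_div]
  have hlex' : ∀ k l : Fin 28, (phiForm δ k / h28 a k < phiForm δ l / h28 a l ∨
      (phiForm δ k / h28 a k = phiForm δ l / h28 a l ∧ phiForm Δ l / h28 a l < phiForm Δ k / h28 a k)) →
        phiForm δ₀ k / h28 a k < phiForm δ₀ l / h28 a l := by
    intro k l h
    refine hlex₀ k l (h.imp_right fun h' => ⟨h'.1, ?_⟩)
    rw [hneg, hneg, neg_lt_neg_iff]
    exact h'.2
  obtain ⟨t₁, ht₁, hw₁⟩ := exists_lex_window a δ Δ
  obtain ⟨t₂, ht₂, hw₂⟩ := exists_lex_window a δ (-Δ)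
  refine ⟨min t₁ t₂, lt_min ht₁ ht₂, fun t ht => ?_⟩
  rcases ht.1.eq_or_lt with h0 | ht0
  · rw [← h0, zero_smul, add_zero, sub_zero, zero_mul,
      show cuspSlope a T δ + cuspSlope a T δ - 2 * cuspSlope a T δ = 0 by ring, abs_zero]
  have ht1 : t ≤ t₁ := ht.2.trans (min_le_left _ _)
  have ht2 : t ≤ t₂ := ht.2.trans (min_le_right _ _)
  -- `δ` and `δ − t·Δ` are refined by `δ₀`
  have hδ : ∀ k l : Fin 28, phiForm δ k / h28 a k < phiForm δ l / h28 a l →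
      phiForm δ₀ k / h28 a k < phiForm δ₀ l / h28 a l := fun k l h => hlex₀ k l (Or.inl h)
  have hδm : ∀ k l : Fin 28, phiForm (δ - t • Δ) k / h28 a k < phiForm (δ - t • Δ) l / h28 a l →
      phiForm δ₀ k / h28 a k < phiForm δ₀ l / h28 a l := fun k l h => by
    rw [sub_eq_add_neg, ← smul_neg] at h
    exact hlex₀ k l ((hw₂ t ht0 ht2 k l).mp h)
  have eδ := cuspSlope_eq_greedy_canonical_of_refines hpos hT hper hF hgen δ hδ
  have eδm := cuspSlope_eq_greedy_canonical_of_refines hpos hT hper hF hgen (δ - t • Δ) hδm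
  -- the gauge at `δ + t·Δ`
  have hup := cuspSlope_le_greedy_add_countGauge_canonical hpos hT hper hF hgen (δ + t • Δ)
  have hlo := greedy_sub_countGauge_le_cuspSlope_canonical hpos hT hper hF hgen (δ + t • Δ)
  -- the gauge is at most `t` times the tie sum
  have hE : (∑ k, ∑ l, if phiForm δ₀ k / h28 a k < phiForm δ₀ l / h28 a l then
      ((((Finset.range ((bkpts a T).card - 1)).filter fun m =>
          (∃ z : ℤ, bkpt a T m * h28 a k = z) ∧ ∃ z : ℤ, bkpt a T m * h28 a l = z).card : ℕ) : ℝ) *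
        max (phiForm (δ + t • Δ) k / h28 a k - phiForm (δ + t • Δ) l / h28 a l) 0 else 0) ≤
      t * ∑ k, ∑ l, if k ≠ l ∧ phiForm δ k / h28 a k = phiForm δ l / h28 a l then
        ((((Finset.range ((bkpts a T).card - 1)).filter fun m =>
            (∃ z : ℤ, bkpt a T m * h28 a k = z) ∧ ∃ z : ℤ, bkpt a T m * h28 a l = z).card : ℕ) : ℝ) *
          max (phiForm Δ k / h28 a k - phiForm Δ l / h28 a l) 0 else 0 := by
    rw [Finset.mul_sum]
    refine Finset.sum_le_sum fun k _ => ?_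
    rw [Finset.mul_sum]
    refine Finset.sum_le_sum fun l _ => ?_
    exact gauge_term_le_tie_term ht0 (hw₁ t ht0 ht1) hlex' (Nat.cast_nonneg _) k l
  -- the chamber functional is linear along the segment
  have hlin : ∑ k, (F (Finset.univ.filter fun l => phiForm δ₀ k / h28 a k ≤ phiForm δ₀ l / h28 a l) -
        F (Finset.univ.filter fun l => phiForm δ₀ k / h28 a k < phiForm δ₀ l / h28 a l)) *
        (phiForm (δ + t • Δ) k / h28 a k) +
      ∑ k, (F (Finset.univ.filter fun l => phiForm δ₀ k / h28 a k ≤ phiForm δ₀ l / h28 a l) -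
        F (Finset.univ.filter fun l => phiForm δ₀ k / h28 a k < phiForm δ₀ l / h28 a l)) *
        (phiForm (δ - t • Δ) k / h28 a k) -
      2 * ∑ k, (F (Finset.univ.filter fun l => phiForm δ₀ k / h28 a k ≤ phiForm δ₀ l / h28 a l) -
        F (Finset.univ.filter fun l => phiForm δ₀ k / h28 a k < phiForm δ₀ l / h28 a l)) *
        (phiForm δ k / h28 a k) = 0 := by
    rw [Finset.mul_sum, ← Finset.sum_add_distrib, ← Finset.sum_sub_distrib]
    refine Finset.sum_eq_zero fun k _ => ?_
    rw [sub_eq_add_neg δ, ← neg_smul, rate_add_smul, rate_add_smul]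
    ring
  rw [abs_le]
  constructor <;> linarith

open scoped Classical in
/-- **TIES ON JUNCTION-FREE WALLS ARE INVISIBLE**: if every tied wall of `δ` carries NO junction of the period (`J_{kl} = 0` whenever
`k ≠ l` and `r_k(δ) = r_l(δ)`), then for every `Δ` the symmetric second difference of `σ` at `δ` along `Δ` VANISHES on an initial
segment `[0, t₀]`. -/
theorem cuspSlope_symm_add_smul_eq_zero_of_no_junction {a : Dir} (hpos : ∀ k, 0 < h28 a k) {T : ℝ} (hT : 0 < T)
    (hper : ∀ k : Fin 28, ∃ z : ℤ, T * h28 a k = z) {F : Finset (Fin 28) → ℝ}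
    (hF : ∀ A, F A = ∑ m ∈ Finset.range ((bkpts a T).card - 1), ((patternN a (bkpt a T m) A : ℤ) : ℝ))
    (δ : Fin 8 → ℝ)
    (hnoj : ∀ k l : Fin 28, k ≠ l → phiForm δ k / h28 a k = phiForm δ l / h28 a l →
      ((Finset.range ((bkpts a T).card - 1)).filter fun m =>
        (∃ z : ℤ, bkpt a T m * h28 a k = z) ∧ ∃ z : ℤ, bkpt a T m * h28 a l = z).card = 0)
    (Δ : Fin 8 → ℝ) :
    ∃ t₀ : ℝ, 0 < t₀ ∧ ∀ t ∈ Icc (0 : ℝ) t₀,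
      cuspSlope a T (δ + t • Δ) + cuspSlope a T (δ - t • Δ) - 2 * cuspSlope a T δ = 0 := by
  obtain ⟨t₀, ht₀, h⟩ := cuspSlope_symm_add_smul_abs_le hpos hT hper hF δ Δ
  refine ⟨t₀, ht₀, fun t ht => ?_⟩
  have h1 := h t ht
  have hS : (∑ k, ∑ l, if k ≠ l ∧ phiForm δ k / h28 a k = phiForm δ l / h28 a l then
      ((((Finset.range ((bkpts a T).card - 1)).filter fun m =>
          (∃ z : ℤ, bkpt a T m * h28 a k = z) ∧ ∃ z : ℤ, bkpt a T m * h28 a l = z).card : ℕ) : ℝ) *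
        max (phiForm Δ k / h28 a k - phiForm Δ l / h28 a l) 0 else 0) = 0 := by
    refine Finset.sum_eq_zero fun k _ => Finset.sum_eq_zero fun l _ => ?_
    split_ifs with hkl
    · rw [hnoj k l hkl.1 hkl.2, Nat.cast_zero, zero_mul]
    · rfl
  rw [hS, mul_zero] at h1
  exact abs_nonpos_iff.mp h1

open scoped Classical in
/-- **… INDEED `σ` IS ONE CHAMBER FUNCTIONAL NEAR SUCH A DISPLACEMENT**: if every tied wall of `δ` is junction-free and `δ₀` is ANY
generic reference refining `δ`, then `σ(δ') = Σ_k W_k(δ₀)·r_k(δ')` for all `δ'` in a NEIGHBOURHOOD of `δ` (near `δ` the only walls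
that can be inverted relative to `δ₀` are the tied walls of `δ`, whose junction counts vanish: the gauge is zero). -/
theorem cuspSlope_eq_greedy_near_of_no_junction {a : Dir} (hpos : ∀ k, 0 < h28 a k) {T : ℝ} (hT : 0 < T)
    (hper : ∀ k : Fin 28, ∃ z : ℤ, T * h28 a k = z) {F : Finset (Fin 28) → ℝ}
    (hF : ∀ A, F A = ∑ m ∈ Finset.range ((bkpts a T).card - 1), ((patternN a (bkpt a T m) A : ℤ) : ℝ))
    (δ : Fin 8 → ℝ)
    (hnoj : ∀ k l : Fin 28, k ≠ l → phiForm δ k / h28 a k = phiForm δ l / h28 a l →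
      ((Finset.range ((bkpts a T).card - 1)).filter fun m =>
        (∃ z : ℤ, bkpt a T m * h28 a k = z) ∧ ∃ z : ℤ, bkpt a T m * h28 a l = z).card = 0)
    {δ₀ : Fin 8 → ℝ} (hgen : ∀ k l : Fin 28, k ≠ l → phiForm δ₀ k / h28 a k ≠ phiForm δ₀ l / h28 a l)
    (href : ∀ k l : Fin 28, phiForm δ k / h28 a k < phiForm δ l / h28 a l →
      phiForm δ₀ k / h28 a k < phiForm δ₀ l / h28 a l) :
    ∀ᶠ δ' in 𝓝 δ, cuspSlope a T δ' =
      ∑ k, (F (Finset.univ.filter fun l => phiForm δ₀ k / h28 a k ≤ phiForm δ₀ l / h28 a l) -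
          F (Finset.univ.filter fun l => phiForm δ₀ k / h28 a k < phiForm δ₀ l / h28 a l)) *
        (phiForm δ' k / h28 a k) := by
  have hc : ∀ k, Continuous fun θ : Fin 8 → ℝ => phiForm θ k / h28 a k := fun k =>
    (continuous_phiForm k).div_const _
  -- near `δ` every strict rate inequality of `δ` persists
  have hnear : ∀ᶠ δ' in 𝓝 δ, ∀ k l : Fin 28, phiForm δ k / h28 a k < phiForm δ l / h28 a l →
      phiForm δ' k / h28 a k < phiForm δ' l / h28 a l := by
    rw [Filter.eventually_all]
    intro k
    rw [Filter.eventually_all]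
    intro l
    by_cases hkl : phiForm δ k / h28 a k < phiForm δ l / h28 a l
    · filter_upwards [((hc k).continuousAt).eventually_lt ((hc l).continuousAt) hkl] with δ' h _
      exact h
    · exact Filter.Eventually.of_forall fun _ h => absurd h hkl
  filter_upwards [hnear] with δ' hδ'
  have hup := cuspSlope_le_greedy_add_countGauge_canonical hpos hT hper hF hgen δ'
  have hlo := greedy_sub_countGauge_le_cuspSlope_canonical hpos hT hper hF hgen δ'
  -- the gauge vanishes at `δ'`
  have hE : (∑ k, ∑ l, if phiForm δ₀ k / h28 a k < phiForm δ₀ l / h28 a l then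
      ((((Finset.range ((bkpts a T).card - 1)).filter fun m =>
          (∃ z : ℤ, bkpt a T m * h28 a k = z) ∧ ∃ z : ℤ, bkpt a T m * h28 a l = z).card : ℕ) : ℝ) *
        max (phiForm δ' k / h28 a k - phiForm δ' l / h28 a l) 0 else 0) = 0 := by
    refine Finset.sum_eq_zero fun k _ => Finset.sum_eq_zero fun l _ => ?_
    by_cases h0 : phiForm δ₀ k / h28 a k < phiForm δ₀ l / h28 a l
    · rw [if_pos h0]
      have hkl : k ≠ l := fun h => by rw [h] at h0; exact lt_irrefl _ h0
      rcases lt_trichotomy (phiForm δ k / h28 a k) (phiForm δ l / h28 a l) with h | h | h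
      · rw [max_eq_right (by linarith [hδ' k l h]), mul_zero]
      · rw [hnoj k l hkl h, Nat.cast_zero, zero_mul]
      · exact absurd ((href l k h).trans h0) (lt_irrefl _)
    · rw [if_neg h0]
  linarith

/-! ### Transfer to the translate integral on the rate ball -/

open scoped Classical in
/-- **THE KINK OF `P` AT ANY TRANSLATE OF THE BALL IS BOUNDED BY THE JUNCTION COUNTS OF ITS TIED WALLS.** All 28 forms of `a`
positive, `T > 0` a period, `F` the canonical period pattern function; `δ` a translate of the OPEN rate ball (`|r_k(δ)| < ρ̄`,
`2ρ̄·T·x_max² < 1`, `2ρ̄·x_max < 1`, `2ρ̄·x_max < wallDist a T`). Then for every `Δ` there is `t₀ > 0` with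
`|P(δ + t·Δ) + P(δ − t·Δ) − 2P(δ)| ≤ t·Σ_k Σ_l [k ≠ l ∧ r_k(δ) = r_l(δ)]·J_{kl}·max(r_k(Δ) − r_l(Δ), 0)` on `[0, t₀]`. -/
theorem translateIntegral_symm_add_smul_abs_le {a : Dir} (hpos : ∀ k, 0 < h28 a k) {T : ℝ} (hT : 0 < T)
    (hper : ∀ k : Fin 28, ∃ z : ℤ, T * h28 a k = z) {F : Finset (Fin 28) → ℝ}
    (hF : ∀ A, F A = ∑ m ∈ Finset.range ((bkpts a T).card - 1), ((patternN a (bkpt a T m) A : ℤ) : ℝ))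
    {δ : Fin 8 → ℝ} {ρb : ℝ} (hρ : ∀ k, |phiForm δ k / h28 a k| < ρb) (hρT : 2 * ρb * T * xMax a ^ 2 < 1)
    (hc1 : 2 * ρb * xMax a < 1) (hc2 : 2 * ρb * xMax a < wallDist a T) (Δ : Fin 8 → ℝ) :
    ∃ t₀ : ℝ, 0 < t₀ ∧ ∀ t ∈ Icc (0 : ℝ) t₀,
      |translateIntegral a T (δ + t • Δ) + translateIntegral a T (δ - t • Δ) - 2 * translateIntegral a T δ| ≤
        t * ∑ k, ∑ l, if k ≠ l ∧ phiForm δ k / h28 a k = phiForm δ l / h28 a l then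
          ((((Finset.range ((bkpts a T).card - 1)).filter fun m =>
              (∃ z : ℤ, bkpt a T m * h28 a k = z) ∧ ∃ z : ℤ, bkpt a T m * h28 a l = z).card : ℕ) : ℝ) *
            max (phiForm Δ k / h28 a k - phiForm Δ l / h28 a l) 0 else 0 := by
  obtain ⟨t₁, ht₁, h₁⟩ := rates_le_of_abs_le hρ Δ
  obtain ⟨t₂, ht₂, h₂⟩ := cuspSlope_symm_add_smul_abs_le hpos hT hper hF δ Δ
  refine ⟨min t₁ t₂, lt_min ht₁ ht₂, fun t ht => ?_⟩
  have ht₁' : |t| ≤ t₁ := by rw [abs_of_nonneg ht.1]; exact ht.2.trans (min_le_left _ _)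
  have hδp := h₁ t ht₁'
  have hδm := h₁ (-t) (by rw [abs_neg]; exact ht₁')
  simp only [neg_smul, ← sub_eq_add_neg] at hδm
  have hPp := translateIntegral_sub_eq_cuspSlope_sub_of_rates_le hpos hT hper hδp (fun k => (hρ k).le) hρT hc1 hc2
  have hPm := translateIntegral_sub_eq_cuspSlope_sub_of_rates_le hpos hT hper hδm (fun k => (hρ k).le) hρT hc1 hc2
  have e : translateIntegral a T (δ + t • Δ) + translateIntegral a T (δ - t • Δ) - 2 * translateIntegral a T δ =
      cuspSlope a T (δ + t • Δ) + cuspSlope a T (δ - t • Δ) - 2 * cuspSlope a T δ := by linarith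
  rw [e]
  exact h₂ t ⟨ht.1, ht.2.trans (min_le_right _ _)⟩

open scoped Classical in
/-- **`P` IS DIFFERENTIABLE AT EVERY TRANSLATE OF THE BALL WHOSE TIED WALLS ARE JUNCTION-FREE**, with derivative the chamber
functional of ANY generic refinement `δ₀` of `δ`: `fderiv ℝ P δ Δ = Σ_k W_k(δ₀)·φ_k(Δ)/h_k(a)` (file (4)'s
`hasFDerivAt_translateIntegral_of_rates_lt` is the case of no tie; zero rates and junction-free ties are both invisible to `P`
inside the ball). -/
theorem hasFDerivAt_translateIntegral_of_no_junction {a : Dir} (hpos : ∀ k, 0 < h28 a k) {T : ℝ} (hT : 0 < T)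
    (hper : ∀ k : Fin 28, ∃ z : ℤ, T * h28 a k = z) {F : Finset (Fin 28) → ℝ}
    (hF : ∀ A, F A = ∑ m ∈ Finset.range ((bkpts a T).card - 1), ((patternN a (bkpt a T m) A : ℤ) : ℝ))
    {δ : Fin 8 → ℝ}
    (hnoj : ∀ k l : Fin 28, k ≠ l → phiForm δ k / h28 a k = phiForm δ l / h28 a l →
      ((Finset.range ((bkpts a T).card - 1)).filter fun m =>
        (∃ z : ℤ, bkpt a T m * h28 a k = z) ∧ ∃ z : ℤ, bkpt a T m * h28 a l = z).card = 0)
    {δ₀ : Fin 8 → ℝ} (hgen : ∀ k l : Fin 28, k ≠ l → phiForm δ₀ k / h28 a k ≠ phiForm δ₀ l / h28 a l)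
    (href : ∀ k l : Fin 28, phiForm δ k / h28 a k < phiForm δ l / h28 a l →
      phiForm δ₀ k / h28 a k < phiForm δ₀ l / h28 a l)
    {ρb : ℝ} (hρ : ∀ k, |phiForm δ k / h28 a k| < ρb) (hρT : 2 * ρb * T * xMax a ^ 2 < 1)
    (hc1 : 2 * ρb * xMax a < 1) (hc2 : 2 * ρb * xMax a < wallDist a T) :
    DifferentiableAt ℝ (translateIntegral a T) δ ∧ ∀ Δ : Fin 8 → ℝ, fderiv ℝ (translateIntegral a T) δ Δ =
      ∑ k, (F (Finset.univ.filter fun l => phiForm δ₀ k / h28 a k ≤ phiForm δ₀ l / h28 a l) -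
          F (Finset.univ.filter fun l => phiForm δ₀ k / h28 a k < phiForm δ₀ l / h28 a l)) *
        (phiForm Δ k / h28 a k) := by
  -- the chamber functional of `δ₀` as a continuous linear map
  set W : Fin 28 → ℝ := fun k => F (Finset.univ.filter fun l => phiForm δ₀ k / h28 a k ≤ phiForm δ₀ l / h28 a l) -
      F (Finset.univ.filter fun l => phiForm δ₀ k / h28 a k < phiForm δ₀ l / h28 a l) with hW
  let Lₗ : (Fin 8 → ℝ) →ₗ[ℝ] ℝ :=
    { toFun := fun Δ => ∑ k, W k * (phiForm Δ k / h28 a k)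
      map_add' := fun Δ Δ' => by
        rw [← Finset.sum_add_distrib]
        exact Finset.sum_congr rfl fun k _ => by rw [phiForm_add]; ring
      map_smul' := fun c Δ => by
        rw [RingHom.id_apply, smul_eq_mul, Finset.mul_sum]
        exact Finset.sum_congr rfl fun k _ => by rw [phiForm_smul]; ring }
  set L : (Fin 8 → ℝ) →L[ℝ] ℝ := LinearMap.toContinuousLinearMap Lₗ with hL
  have hLapply : ∀ Δ, L Δ = ∑ k, W k * (phiForm Δ k / h28 a k) := fun Δ => rfl
  -- near `δ`: `σ = L` and inside the ball
  have hσ := cuspSlope_eq_greedy_near_of_no_junction hpos hT hper hF δ hnoj hgen href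
  have hball : ∀ᶠ δ' in 𝓝 δ, ∀ k, |phiForm δ' k / h28 a k| ≤ ρb := by
    rw [Filter.eventually_all]
    intro k
    have hc : Continuous fun θ : Fin 8 → ℝ => phiForm θ k / h28 a k := (continuous_phiForm k).div_const _
    filter_upwards [(hc.abs.continuousAt).eventually_lt continuousAt_const (hρ k)] with δ' h
    exact h.le
  have hσδ : cuspSlope a T δ = L δ := by rw [hLapply]; exact hσ.self_of_nhds
  have haff : (fun δ' => translateIntegral a T δ + (L δ' - L δ)) =ᶠ[𝓝 δ] translateIntegral a T := by
    filter_upwards [hσ, hball] with δ' hσ' hδ'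
    have hP := translateIntegral_sub_eq_cuspSlope_sub_of_rates_le hpos hT hper hδ' (fun k => (hρ k).le) hρT hc1 hc2
    rw [hσ', hσδ, ← hLapply] at hP
    linarith
  have hderiv : HasFDerivAt (translateIntegral a T) L δ := by
    have h1 : HasFDerivAt (fun δ' => translateIntegral a T δ + (L δ' - L δ)) L δ :=
      (L.hasFDerivAt.sub_const (L δ)).const_add (translateIntegral a T δ)
    exact h1.congr_of_eventuallyEq haff.symm
  exact ⟨hderiv.differentiableAt, fun Δ => by rw [hderiv.fderiv, hLapply]⟩

end Summit.KontsevichZagierPeriods.Zeta5Search.Barrier.ConeGamma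

end
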